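import Summits.MatrixMultiplication.OmegaCensus.ThreeSetLineModFourSliceParityAlgebra
import Summits.MatrixMultiplication.OmegaCensus.ThreeSetLineModFourSliceTailSound
import Summits.MatrixMultiplication.OmegaCensus.ThreeSetLineModFourSliceExcSound
import HarnessLib

/-!
# The bit-sliced MOD-4 FILTER, XII: soundness of the parity kill and of the general block checker `blockChkG`

ω-census `pub-omega`, family (b3), seat pub-omega-group gen 42.  Framing: lottery ticket; floor = certified bounds/negative
ranges.  VALUE: a kernel TOOL for the three-set cube cells `(4, d, e)@p²` (`ThreeSetZpCells4Core`); NOT progress on ω.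
`testBit_evalPlaneSum` (sliced evaluation = parity of odd counts), `dead_of_parityKill` (a set bit of `parityKill` below `L` ⇒ the
datum admits no solution), and **`blockChkG_sound`**: `LineMod.blockChkG … = true` ⇒ no datum of
`(compsLit n j).map (fun l => pre ++ bumpHead c₀ l)` admits a solution (sliced filter / parity kill / declared exception → norm filter); assembly helpers (`bumpHead 0 = id`).
-/

namespace Summit.MatrixMultiplication.OmegaCensus

/-! # The parity-local obstruction: sliced evaluation and the soundness of `blockChkG` -/

namespace LineMod

open Finset

/-- Bits of a sliced digit from its value. [folklore] -/
theorem testBit_of_val2_eq {k : ℕ} {a : S2} {x : ℕ} (h : val2 k a = (x : ZMod 4)) :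
    a.1.testBit k = x.testBit 0 ∧ a.2.testBit k = x.testBit 1 := by
  rw [natCast_eq_bits] at h
  unfold val2 bv at h
  revert h
  cases a.1.testBit k <;> cases a.2.testBit k <;> cases x.testBit 0 <;> cases x.testBit 1 <;> decide

/-- Sliced evaluation plane: bit `k` is the parity of the number of `v < cnt` with bit `b` of `lfsr (a v mod p)` set and an odd
parity plane at `k`. [folklore] -/
theorem testBit_evalPlaneSum (p n m a b k : ℕ) (X : List S2) : ∀ cnt, (evalPlaneSum p n m a b X cnt).testBit k =
    decide ((∑ v ∈ range cnt, if (lfsr n m (a * v % p)).testBit b ∧ (vget X v).1.testBit k = true then 1 else 0) % 2 = 1)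
  | 0 => by simp [evalPlaneSum]
  | cnt + 1 => by
    rw [evalPlaneSum, Nat.testBit_xor, testBit_evalPlaneSum p n m a b k X cnt, sum_range_succ]
    set S := ∑ v ∈ range cnt, if (lfsr n m (a * v % p)).testBit b ∧ (vget X v).1.testBit k = true then 1 else 0
    by_cases hb : (lfsr n m (a * cnt % p)).testBit b
    · rw [if_pos hb]
      cases hx : (vget X cnt).1.testBit k
      · simp [hb]
      · simp only [hb, true_and, if_true, Bool.xor_true]
        rcases Nat.mod_two_eq_zero_or_one S with h | h
        · rw [show (S + 1) % 2 = 1 by omega, h]; decide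
        · rw [show (S + 1) % 2 = 0 by omega, h]; decide
    · rw [if_neg hb, Nat.zero_testBit, Bool.xor_false]
      simp [hb]

/-- A zero bit of `evalNZ` means every coordinate plane `b < cnt` is zero there. [folklore] -/
theorem evalPlane_false_of_evalNZ {k : ℕ} (p n m a : ℕ) (X : List S2) :
    ∀ cnt, (evalNZ p n m a X cnt).testBit k = false → ∀ b < cnt, (evalPlaneSum p n m a b X p).testBit k = false
  | 0, _, b, hb => absurd hb (Nat.not_lt_zero b)
  | cnt + 1, h, b, hb => by
    rw [evalNZ, Nat.testBit_lor, Bool.or_eq_false_iff] at h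
    rcases Nat.lt_succ_iff_lt_or_eq.1 hb with hb' | rfl
    · exact evalPlane_false_of_evalNZ p n m a X cnt h.1 b hb'
    · exact h.2

/-- A set bit of `parityKill` (below `L`) names a root pair at which both evaluations vanish. [folklore] -/
theorem exists_of_parityKill {k L : ℕ} (hk : k < L) (p n m : ℕ) (X : List S2) :
    ∀ as : List ℕ, (parityKill p n m (onesOf L) X as).testBit k = true →
      ∃ a ∈ as, (evalNZ p n m a X n).testBit k = false ∧ (evalNZ p n m (p - a) X n).testBit k = false
  | [], h => by simp [parityKill] at h
  | a :: as, h => by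
    rw [parityKill, Nat.testBit_lor, Bool.or_eq_true] at h
    rcases h with h | h
    · obtain ⟨a', ha', h'⟩ := exists_of_parityKill hk p n m X as h
      exact ⟨a', List.mem_cons_of_mem _ ha', h'⟩
    · have hone : (onesOf L).testBit k = true := by unfold onesOf; rw [Nat.testBit_two_pow_sub_one]; simp [hk]
      rw [Nat.testBit_xor, Nat.testBit_lor, hone] at h
      refine ⟨a, List.mem_cons_self, ?_, ?_⟩ <;>
        cases h1 : (evalNZ p n m a X n).testBit k <;> cases h2 : (evalNZ p n m (p - a) X n).testBit k <;> simp_all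

section Sound

variable {p : ℕ} [NeZero p] [Fact p.Prime]

/-- **Parity kill ⇒ dead.**  If the sliced data carry the residues of `Fl` at datum `k < L`, the parameters pass `parityParamsOK`, and
bit `k` of `parityKill` is set, then `Fl` admits no solution of the three-set line identity (any killer `W`, any `K`). [folklore] -/
theorem dead_of_parityKill {L k n m : ℕ} {as : List ℕ} {X : List S2} {W Fl : List ℕ} (hk : k < L)
    (hpar : parityParamsOK p n m as = true)
    (hXF : ∀ v : ZMod p, toF p k X v = ((vecFn Fl v : ℕ) : ZMod 4))
    (hkill : (parityKill p n m (onesOf L) X as).testBit k = true) :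
    ∀ (G : ZMod p → ℕ) (s : ZMod p) (K : ℕ),
      ¬ ∀ τ : ZMod p, (∑ u : ZMod p, lineMat3 (vecFn W) (vecFn Fl) τ u * G u) + (if s = τ then 1 else 0) = K := by
  intro G s K
  unfold parityParamsOK at hpar
  simp only [Bool.and_eq_true, decide_eq_true_eq, beq_iff_eq, List.all_eq_true] at hpar
  obtain ⟨⟨⟨hn, _⟩, hgeom⟩, has⟩ := hpar
  obtain ⟨a, ha, hz1, hz2⟩ := exists_of_parityKill hk p n m X as hkill
  obtain ⟨ha0, hap⟩ := has a ha
  haveI : Nontrivial (F2R n m) := nontrivial_F2R m hn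
  -- the geometric sum at ρ = r^a
  have hgr : ∑ i ∈ range p, rt n m ^ i = 0 := geom_sum_rt_eq_zero hn hgeom
  have hρ : ∑ i ∈ range p, (rt n m ^ a) ^ i = 0 := by
    have hk0 : ((a : ℕ) : ZMod p) ≠ 0 := by
      rw [ne_eq, ZMod.natCast_eq_zero_iff]; exact fun h => absurd (Nat.le_of_dvd ha0 h) (not_le.2 hap)
    have := geom_sum_zch_eq_zero hgr hk0
    rwa [zch, ZMod.val_natCast_of_lt hap] at this
  -- the parity planes: bit of the lo-plane at `v < p` is the parity of `Fl v`
  have hlo : ∀ v : ℕ, v < p → (vget X v).1.testBit k = decide ((vecFn Fl (v : ZMod p)) % 2 = 1) := by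
    intro v hv
    have h := (testBit_of_val2_eq (hXF (v : ZMod p))).1
    rw [ZMod.val_natCast_of_lt hv] at h
    rw [h, Nat.testBit_zero]
  -- lev at r^c vanishes when all coordinate planes vanish
  have hlev : ∀ c : ℕ, (evalNZ p n m c X n).testBit k = false → lev (rt n m ^ c) (vecFn (q := p) Fl) = 0 := by
    intro c hc
    rw [lev_rt_pow_eq hn hgeom]
    refine sum_eq_zero fun b hb => ?_
    have hpl := evalPlane_false_of_evalNZ p n m c X n hc b (mem_range.1 hb)
    rw [testBit_evalPlaneSum] at hpl
    have heven : (∑ v ∈ range p, if (lfsr n m (c * v % p)).testBit b ∧ (vget X v).1.testBit k = true then 1 else 0) % 2 = 0 := by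
      have hne : ¬ (∑ v ∈ range p, if (lfsr n m (c * v % p)).testBit b ∧ (vget X v).1.testBit k = true then 1 else 0) % 2 = 1 :=
        fun hc' => by rw [decide_eq_true hc'] at hpl; exact Bool.true_eq_false.mp hpl |>.elim
      omega
    have hcount : oddCount p n m c b (fun v => vecFn Fl (v : ZMod p)) p =
        ∑ v ∈ range p, if (lfsr n m (c * v % p)).testBit b ∧ (vget X v).1.testBit k = true then 1 else 0 := by
      unfold oddCount
      refine sum_congr rfl fun v hv => ?_
      rw [hlo v (mem_range.1 hv)]
      simp only [decide_eq_true_eq]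
    rw [hcount, natCast_F2R, heven]; simp
  have hF : lev (rt n m ^ a) (vecFn (q := p) Fl) = 0 := hlev a hz1
  have hFc : levc (rt n m ^ a) (vecFn (q := p) Fl) = 0 := by rw [levc_rt_pow_eq hn hgeom hap, hlev (p - a) hz2]
  exact no_line_identity3_of_lev_levc_zero hρ (vecFn W) (vecFn Fl) hF hFc G s K

/-- **Soundness of the general block checker** (tail bump + sliced mod-4 filter + parity kill + declared exceptions). [folklore] -/
theorem blockChkG_sound {K d e : ℕ} {W pre : List ℕ} {n j c₀ : ℕ} {sched : List Bool} {pn pm : ℕ} {pas : List ℕ}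
    {exc : List (ℕ × List ℕ)} {nB nX nM g gi : ℕ} {dlog : List ℕ} {st : List Bool} {ms : List ℤ}
    {uexc : List (List ℕ × List (ℕ × ℕ × ℕ × ℕ))}
    (h : blockChkG p K d e W pre n j c₀ sched pn pm pas exc nB nX nM g gi dlog st ms uexc = true) :
    ∀ Fl ∈ (ZpZpDomino.compsLit n j).map (fun l => pre ++ bumpHead c₀ l), ∀ (G : ZMod p → ℕ) (s : ZMod p), (∀ u, G u ≤ e) →
      ¬ ∀ τ : ZMod p, (∑ u : ZMod p, lineMat3 (vecFn W) (vecFn Fl) τ u * G u) + (if s = τ then 1 else 0) = K := by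
  intro Fl hFl G s hG
  unfold blockChkG at h
  dsimp only at h
  simp only [Bool.and_eq_true, decide_eq_true_eq, beq_iff_eq, Bool.or_eq_true] at h
  obtain ⟨⟨⟨⟨⟨⟨⟨⟨⟨⟨⟨_, hp3⟩, hWlen⟩, hlen⟩, hn⟩, hsum⟩, hc⟩, he⟩, hpar⟩, hexc⟩, hsm⟩, hnorm⟩ := h
  rw [List.mem_map] at hFl
  obtain ⟨l, hl, rfl⟩ := hFl
  obtain ⟨hllen, hlsum⟩ := length_sum_of_mem_compsLit n j l hl
  have hlne : l ≠ [] := by rintro rfl; simp at hllen; omega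
  obtain ⟨_, hrep⟩ := blockPlanes_spec pre n j
  obtain ⟨k, hk, hbits⟩ := hrep l hl
  set B := blockPlanes pre n j with hB
  set L := B.1
  set X := bumpDigits p (onesOf L) pre.length c₀ (sdigits p B.2) with hX
  have hFlen : (pre ++ bumpHead c₀ l).length = p := by
    obtain ⟨a, t, rfl⟩ := List.exists_cons_of_ne_nil hlne
    rw [bumpHead, List.length_append, List.length_cons, ← hlen, ← hllen, List.length_cons]
  have hFsum : (pre ++ bumpHead c₀ l).sum = d := by
    obtain ⟨a, t, rfl⟩ := List.exists_cons_of_ne_nil hlne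
    rw [bumpHead, List.sum_append, List.sum_cons, ← hsum, ← hlsum, List.sum_cons]; ring
  -- the sliced digits carry the residues of the datum
  have hXF : ∀ v : ZMod p, toF p k X v = ((vecFn (pre ++ bumpHead c₀ l) v : ℕ) : ZMod 4) := by
    intro v
    unfold toF vecFn
    rw [hX]; unfold bumpDigits
    rw [vget_range_map _ (ZMod.val_lt v), getD_bumpHead_append pre c₀ hlne, Nat.cast_add, natCast_eq_bits ((pre ++ l).getD v.val 0)]
    have hdig : val2 k (vget (sdigits p B.2) v.val) =
        (if ((pre ++ l).getD v.val 0).testBit 0 then 1 else 0) + 2 * (if ((pre ++ l).getD v.val 0).testBit 1 then 1 else 0) := by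
      unfold sdigits
      rw [vget_range_map _ (ZMod.val_lt v)]
      unfold val2 bv
      rw [show (B.2.getD v.val []).getD 0 0 = pl B.2 v.val 0 from rfl, show (B.2.getD v.val []).getD 1 0 = pl B.2 v.val 1 from rfl,
        hbits v.val 0 (by norm_num), hbits v.val 1 (by norm_num)]
    by_cases hv : v.val = pre.length
    · rw [if_pos hv, if_pos hv, val2_add2, hdig, val2_cst2 hk]
    · rw [if_neg hv, if_neg hv, hdig, Nat.cast_zero, add_zero]
  -- bit `k` of the combined mask
  have hbit := congrArg (fun x => x.testBit k) hsm
  simp only [Nat.testBit_lor, Nat.testBit_land, Nat.testBit_xor] at hbit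
  have hone : (onesOf L).testBit k = true := by unfold onesOf; rw [Nat.testBit_two_pow_sub_one]; simp [hk]
  rw [hone] at hbit
  by_cases hsk : (survMask p (onesOf L) K e W X sched).testBit k = false
  · exact dead_of_survMask_testBit_of_digits hp3 hWlen hFlen hFsum hc he hk hXF hsk G s
  by_cases hpk : (parityKill p pn pm (onesOf L) X pas).testBit k = true
  · exact dead_of_parityKill hk hpar hXF hpk G s K
  · -- a declared exception
    rw [Bool.eq_false_iff.not, not_not] at hsk
    rw [Bool.not_eq_true] at hpk
    rw [hsk, hpk] at hbit
    have hek : (excMask exc).testBit k = true := by simpa using hbit.symm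
    obtain ⟨F, hF⟩ := exists_of_excMask_testBit exc hek
    rw [List.all_eq_true] at hexc
    have hcF := hexc _ hF
    unfold excChkD at hcF
    simp only [Bool.and_eq_true, decide_eq_true_eq, beq_iff_eq, List.all_eq_true, List.mem_range] at hcF
    obtain ⟨⟨hFlen', hFsum'⟩, hFi⟩ := hcF
    have hFl : pre ++ bumpHead c₀ l = F := by
      symm
      refine list_eq_of_getD_le hFlen' hFlen (by rw [hFsum', hFsum]) ?_
      intro i hi
      obtain ⟨⟨hle3, hb0⟩, hb1⟩ := hFi i hi
      have hx := testBit_of_val2_eq (hXF (i : ZMod p))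
      unfold toF vecFn at hx
      rw [ZMod.val_natCast_of_lt hi] at hx
      have e0 := hx.1.symm.trans hb0
      have e1 := hx.2.symm.trans hb1
      have hm := mod_four_eq_of_testBit e0 e1
      omega
    rw [hFl]
    rcases hnorm with hemp | hnorm
    · rw [List.isEmpty_iff] at hemp; rw [hemp] at hF; simp at hF
    · exact LineNorm.normBlockX_sound (p := p) hnorm F (List.mem_map.2 ⟨(k, F), hF, rfl⟩) G s hG

end Sound

end LineMod

/-! ## Assembly helpers for `blockChkG` blocks (bump `0` is the identity) -/

namespace LineMod

/-- `bumpHead 0` is the identity. [folklore] -/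
theorem bumpHead_zero (l : List ℕ) : bumpHead 0 l = l := by
  cases l with
  | nil => rfl
  | cons a t => rw [bumpHead, Nat.add_zero]

/-- A `blockChkG` block with bump `0` is an ordinary block. [folklore] -/
theorem forall_block_of_blockG0 {P : List ℕ → Prop} (pre : List ℕ) (L : List (List ℕ))
    (h : ∀ Fl ∈ L.map (fun l => pre ++ bumpHead 0 l), P Fl) : ∀ Fl ∈ L.map (pre ++ ·), P Fl := by
  intro Fl hFl
  rw [List.mem_map] at hFl
  obtain ⟨l, hl, rfl⟩ := hFl
  exact h _ (List.mem_map.2 ⟨l, hl, by rw [bumpHead_zero]⟩)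

/-- The root block in `blockChkG` form: `(compsLit n j).map (fun l => [] ++ bumpHead 0 l)` is `compsLit n j`. [folklore] -/
theorem forall_of_forall_blockG_nil {P : List ℕ → Prop} (n j : ℕ)
    (h : ∀ Fl ∈ (ZpZpDomino.compsLit n j).map (fun l => ([] : List ℕ) ++ bumpHead 0 l), P Fl) :
    ∀ Fl ∈ ZpZpDomino.compsLit n j, P Fl :=
  fun Fl hFl => h Fl (List.mem_map.2 ⟨Fl, hFl, by rw [bumpHead_zero]; rfl⟩)

end LineMod

end Summit.MatrixMultiplication.OmegaCensus
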